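import Summits.CriticalPhenomena.PercolationContinuityZ3.Theorems.PercNearOneGluingNoHeavyLowerTailKnQuestion8CoefficientwiseRemApex
import Summits.CriticalPhenomena.PercolationContinuityZ3.Theorems.PercNearOneGluingNoHeavyLowerTailKnQuestion8CoefficientwiseApex
import HarnessLib

/-!
# THEOREM CONE-SPOKE: (REM) ≥ 0 for every target set on every full cone rooted at a spoke from the base — in particular on every complete graph — prim-lf-2 gen 70

Helper file (`--supports stmt-CriticalPhenomena-4575`, closed), prover `prim-lf-2` (gen 70).  Memo `prim-lf-2/CW-STRIP-gen70.md` §5d.  No sorries; standard axioms.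

Chain: THEOREM 0 (`rem_nonneg_of_pieceRows_union`, gen 69) + identity point rows when the second terminal is dominating (`rem_nonneg_of_dom_snd_of_rowN`, gen 70)
reduce `REM_E(e;x,W) ≥ 0` to the linear N-row of `D = E.erase e`; on a cone (apex `p` joined to every vertex `∉ {x,p}`, no edge `x–p` left in `D`) the class `N`
is `{p ∉ A ∪ B} ∩ {W meets A} ∩ {W misses B}` (`A = C_x t`, `B = C_x(D∖t)`), the complement involution turns `Σ_N (g A − g B)` into one half of gen 26's
two-sided kernel `Σ_{p ∉ A∪B} (g A − g B)(h_W A − h_W B)` with the monotone indicator `h_W(S) = [W ∩ S ≠ ∅]`, and THEOREM APEX (`cwpa_apex`, gen 26) says that kernel is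
nonnegative.
* `Coefficientwise.rowN_sum_nonneg_of_cone` — the linear N-row inequality on a cone piece;
* `Coefficientwise.rem_nonneg_cone_spoke` — **(REM) for every `W` and monotone `g` whenever `E.erase e` is a cone with apex `p` over the other vertices and `e = xp` is the
  only `x–p` edge** (wheels at a spoke rooted on the rim, `K_n` at any edge, double cones at an apex–path edge from the path, apex graphs).
[cite: KozmaNitzan2024, Questions 8–9 (§5.5 p. 36) (context: the Question-8 pocket covariance programme)]
-/

namespace Summit.CriticalPhenomena.PercolationContinuityZ3.Theorems

open Finset Literature.Probability.Percolation

namespace Coefficientwise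

variable {ι V : Type*} (ends : ι → Sym2 V)

open Classical

/-- On a cone piece (apex `p` joined to every vertex `∉ {x,p}`), if `p ∉ C_x(t)` and `p ∉ C_x(D∖t)` then the two clusters of `x` meet only in `x`.
[cite: KozmaNitzan2024, Questions 8–9 (§5.5 p. 36) (context)] -/
theorem cone_core_eq {D : Finset ι} {x p : V} (hdom : ∀ e ∈ D, ∀ v : V, v ∈ ends e → v ≠ p → v ≠ x → ∃ f ∈ D, ends f = s(p, v))
    {t : Finset ι} (htD : t ⊆ D) (hpA : p ∉ openCluster (ends '' (↑t : Set ι)) x) (hpB : p ∉ openCluster (ends '' (↑(D \ t) : Set ι)) x)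
    {v : V} (hvA : v ∈ openCluster (ends '' (↑t : Set ι)) x) (hvB : v ∈ openCluster (ends '' (↑(D \ t) : Set ι)) x) : v = x := by
  by_contra hvx
  have hvp : v ≠ p := fun h => hpA (h ▸ hvA)
  obtain ⟨e, het, hve⟩ := exists_edge_of_mem_openCluster ends hvA hvx
  obtain ⟨f, hfD, hfe⟩ := hdom e (htD het) v hve hvp hvx
  by_cases hft : f ∈ t
  · exact hpA (mem_openCluster_of_edge ends hft (show ends f = s(v, p) by rw [hfe, Sym2.eq_swap]) hvA)
  · exact hpB (mem_openCluster_of_edge ends (Finset.mem_sdiff.mpr ⟨hfD, hft⟩) (show ends f = s(v, p) by rw [hfe, Sym2.eq_swap]) hvB)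

/-- On a cone piece with `p ∉ A ∪ B`: a vertex `w ≠ x` of `A = C_x(t)` hangs blue from the apex, i.e. `w ∈ C_p(D∖t)`; symmetrically for `B`.
[cite: KozmaNitzan2024, Questions 8–9 (§5.5 p. 36) (context)] -/
theorem cone_red_mem_blue_apex {D : Finset ι} {x p : V} (hdom : ∀ e ∈ D, ∀ v : V, v ∈ ends e → v ≠ p → v ≠ x → ∃ f ∈ D, ends f = s(p, v))
    {t : Finset ι} (htD : t ⊆ D) (hpA : p ∉ openCluster (ends '' (↑t : Set ι)) x)
    {w : V} (hwA : w ∈ openCluster (ends '' (↑t : Set ι)) x) (hwx : w ≠ x) : w ∈ openCluster (ends '' (↑(D \ t) : Set ι)) p := by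
  have hwp : w ≠ p := fun h => hpA (h ▸ hwA)
  obtain ⟨e, het, hwe⟩ := exists_edge_of_mem_openCluster ends hwA hwx
  obtain ⟨f, hfD, hfe⟩ := hdom e (htD het) w hwe hwp hwx
  by_cases hft : f ∈ t
  · exact absurd (mem_openCluster_of_edge ends hft (show ends f = s(w, p) by rw [hfe, Sym2.eq_swap]) hwA) hpA
  · exact mem_openCluster_of_edge ends (Finset.mem_sdiff.mpr ⟨hfD, hft⟩) hfe (mem_openCluster_self _ p)

/-- The same on the blue side: `w ≠ x` in `B = C_x(D∖t)` lies in `C_p(t)`. [cite: KozmaNitzan2024, Questions 8–9 (§5.5 p. 36) (context)] -/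
theorem cone_blue_mem_red_apex {D : Finset ι} {x p : V} (hdom : ∀ e ∈ D, ∀ v : V, v ∈ ends e → v ≠ p → v ≠ x → ∃ f ∈ D, ends f = s(p, v))
    {t : Finset ι} (hpB : p ∉ openCluster (ends '' (↑(D \ t) : Set ι)) x)
    {w : V} (hwB : w ∈ openCluster (ends '' (↑(D \ t) : Set ι)) x) (hwx : w ≠ x) : w ∈ openCluster (ends '' (↑t : Set ι)) p := by
  have hwp : w ≠ p := fun h => hpB (h ▸ hwB)
  obtain ⟨e, heDt, hwe⟩ := exists_edge_of_mem_openCluster ends hwB hwx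
  obtain ⟨f, hfD, hfe⟩ := hdom e (Finset.mem_sdiff.mp heDt).1 w hwe hwp hwx
  by_cases hft : f ∈ t
  · exact mem_openCluster_of_edge ends hft hfe (mem_openCluster_self _ p)
  · exact absurd (mem_openCluster_of_edge ends (Finset.mem_sdiff.mpr ⟨hfD, hft⟩) (show ends f = s(w, p) by rw [hfe, Sym2.eq_swap]) hwB) hpB

/-- **The N-row on a cone piece (linear form).**  `D` a piece with terminals `x ≠ p`, `p` joined to every vertex `∉ {x,p}` of `D` and not to `x`.  Then for every target
set `W` and monotone `g`:  `0 ≤ Σ_{t ⊆ D, N(t)} (g(C_x t ∪ C_p t) − g(C_x(D∖t)))`.  Proof: the class is `{p ∉ A∪B, W∩A ≠ ∅, W∩B = ∅}`; complementing `t ↦ D∖t` gives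
`2·Σ_N (gA − gB) = Σ_{p∉A∪B} (gA−gB)(h_W A − h_W B)`, which is THEOREM APEX (`cwpa_apex`, gen 26) for the monotone pair `(g, h_W)`.
[cite: KozmaNitzan2024, Questions 8–9 (§5.5 p. 36) (context)] -/
theorem rowN_sum_nonneg_of_cone [Fintype V] (D : Finset ι) {x p : V} (hpx : p ≠ x)
    (hdom : ∀ e ∈ D, ∀ v : V, v ∈ ends e → v ≠ p → v ≠ x → ∃ f ∈ D, ends f = s(p, v))
    (hxpD : ∀ i ∈ D, x ∈ ends i → p ∉ ends i) (W : Set V) (g : Set V → ℝ) (hg : Monotone g) :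
    0 ≤ ∑ t ∈ D.powerset.filter (fun t => pieceN ends D x p W t),
      (g (openCluster (ends '' (↑t : Set ι)) x ∪ openCluster (ends '' (↑t : Set ι)) p) - g (openCluster (ends '' (↑(D \ t) : Set ι)) x)) := by
  set K : Finset ι → Set V := fun t => openCluster (ends '' (↑t : Set ι)) x with hK
  set Pc : Finset ι → Set V := fun t => openCluster (ends '' (↑t : Set ι)) p with hPc
  -- the indicator h_W and the sign pattern
  set hW : Set V → ℝ := fun S => if (∃ w ∈ W, w ∈ S) then 1 else 0 with hhW
  have hWmono : Monotone hW := by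
    intro S T hST; simp only [hhW]
    by_cases h : ∃ w ∈ W, w ∈ S
    · obtain ⟨w, hw, hwS⟩ := h
      rw [if_pos ⟨w, hw, hwS⟩, if_pos ⟨w, hw, hST hwS⟩]
    · rw [if_neg h]; split_ifs <;> norm_num
  -- case x ∈ W: the class is empty
  by_cases hxW : x ∈ W
  · refine le_of_eq (Eq.symm (Finset.sum_eq_zero fun t ht => ?_))
    exfalso
    obtain ⟨-, hcl⟩ := Finset.mem_filter.mp ht
    exact hcl.2.2.1 x hxW ⟨mem_openCluster_self _ _, mem_openCluster_self _ _⟩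
  -- the class rewritten
  have hclass : ∀ t, t ⊆ D → (pieceN ends D x p W t ↔
      ((p ∉ K t ∧ p ∉ K (D \ t)) ∧ ((∃ w ∈ W, w ∈ K t) ∧ ¬ (∃ w ∈ W, w ∈ K (D \ t))))) := by
    intro t htD
    constructor
    · rintro ⟨hpA, hpB, -, hnb, ⟨w, hwW, hwA, -⟩⟩
      refine ⟨⟨hpA, hpB⟩, ⟨w, hwW, hwA⟩, ?_⟩
      rintro ⟨w', hw'W, hw'B⟩
      have hw'x : w' ≠ x := fun h => hxW (h ▸ hw'W)
      exact hnb w' hw'W ⟨cone_blue_mem_red_apex ends hdom hpB hw'B hw'x, hw'B⟩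
    · rintro ⟨⟨hpA, hpB⟩, ⟨w, hwW, hwA⟩, hnb⟩
      refine ⟨hpA, hpB, fun w' hw'W hc => ?_, fun w' hw'W hc => hnb ⟨w', hw'W, hc.2⟩, ⟨w, hwW, hwA, ?_⟩⟩
      · exact hxW ((cone_core_eq ends hdom htD hpA hpB hc.1 hc.2) ▸ hw'W)
      · exact cone_red_mem_blue_apex ends hdom htD hpA hwA (fun h => hxW (h ▸ hwW))
  -- Step 1: strong form suffices
  set Z : Finset (Finset ι) := D.powerset.filter (fun t => p ∉ K t ∧ p ∉ K (D \ t)) with hZ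
  set S : ℝ := ∑ t ∈ Z, (if ((∃ w ∈ W, w ∈ K t) ∧ ¬ (∃ w ∈ W, w ∈ K (D \ t))) then (g (K t) - g (K (D \ t))) else 0) with hS
  have hfilter : D.powerset.filter (fun t => pieceN ends D x p W t)
      = Z.filter (fun t => (∃ w ∈ W, w ∈ K t) ∧ ¬ (∃ w ∈ W, w ∈ K (D \ t))) := by
    rw [hZ, Finset.filter_filter]
    refine Finset.filter_congr fun t ht => ?_
    exact hclass t (Finset.mem_powerset.mp ht)
  have hstrong : S ≤ ∑ t ∈ D.powerset.filter (fun t => pieceN ends D x p W t), (g (K t ∪ Pc t) - g (K (D \ t))) := by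
    rw [hfilter, Finset.sum_filter]
    refine Finset.sum_le_sum fun t _ => ?_
    by_cases h : ((∃ w ∈ W, w ∈ K t) ∧ ¬ (∃ w ∈ W, w ∈ K (D \ t)))
    · simp only [if_pos h]; exact sub_le_sub_right (hg Set.subset_union_left) _
    · simp only [if_neg h]; rfl
  refine le_trans ?_ hstrong
  -- Step 2: 2 S = Σ_Z (gK − gB)(hW K − hW B)
  set u : Finset ι → ℝ := fun t => (g (K t) - g (K (D \ t))) * (hW (K t) - hW (K (D \ t))) with hu
  have hmemZ : ∀ t, t ∈ Z ↔ (t ⊆ D ∧ p ∉ K t ∧ p ∉ K (D \ t)) := by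
    intro t; rw [hZ, Finset.mem_filter, Finset.mem_powerset]
  have hsd : ∀ t, t ⊆ D → D \ (D \ t) = t := fun t ht => Finset.sdiff_sdiff_eq_self ht
  -- the 'mirror' sum equals −S by the involution t ↦ D \ t
  have hmirror : ∑ t ∈ Z, (if ((∃ w ∈ W, w ∈ K (D \ t)) ∧ ¬ (∃ w ∈ W, w ∈ K t)) then (g (K t) - g (K (D \ t))) else 0) = - S := by
    rw [hS, ← Finset.sum_neg_distrib]
    refine Finset.sum_bij' (fun t _ => D \ t) (fun t _ => D \ t) ?_ ?_ ?_ ?_ ?_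
    · intro t ht; obtain ⟨htD, h1, h2⟩ := (hmemZ t).mp ht
      exact (hmemZ _).mpr ⟨Finset.sdiff_subset, h2, by rw [hsd t htD]; exact h1⟩
    · intro t ht; obtain ⟨htD, h1, h2⟩ := (hmemZ t).mp ht
      exact (hmemZ _).mpr ⟨Finset.sdiff_subset, h2, by rw [hsd t htD]; exact h1⟩
    · intro t ht; obtain ⟨htD, -, -⟩ := (hmemZ t).mp ht; exact hsd t htD
    · intro t ht; obtain ⟨htD, -, -⟩ := (hmemZ t).mp ht; exact hsd t htD
    · intro t ht; obtain ⟨htD, -, -⟩ := (hmemZ t).mp ht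
      simp only [hsd t htD]
      split_ifs <;> ring
  have htwo : ∑ t ∈ Z, u t = 2 * S := by
    have : ∀ t ∈ Z, u t = (if ((∃ w ∈ W, w ∈ K t) ∧ ¬ (∃ w ∈ W, w ∈ K (D \ t))) then (g (K t) - g (K (D \ t))) else 0)
        - (if ((∃ w ∈ W, w ∈ K (D \ t)) ∧ ¬ (∃ w ∈ W, w ∈ K t)) then (g (K t) - g (K (D \ t))) else 0) := by
      intro t _
      simp only [hu, hhW]
      by_cases ha : ∃ w ∈ W, w ∈ K t <;> by_cases hb : ∃ w ∈ W, w ∈ K (D \ t) <;> simp [ha, hb]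
    rw [Finset.sum_congr rfl this, Finset.sum_sub_distrib, hmirror]; ring
  -- Step 3: THEOREM APEX (gen 26)
  have hapex : ∀ i ∈ D, ∀ v ∈ ends i, v ≠ x → v ≠ p → ∃ j ∈ D, ends j = s(v, p) := by
    intro i hi v hv hvx hvp
    obtain ⟨j, hj, hje⟩ := hdom i hi v hv hvp hvx
    exact ⟨j, hj, by rw [hje, Sym2.eq_swap]⟩
  have hcw := cwpa_apex ends D x p hpx Finset.univ (fun _ _ _ _ => Finset.mem_univ _) hxpD hapex g hW hg hWmono
  have hZu : (0 : ℝ) ≤ ∑ t ∈ Z, u t := by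
    rw [hZ]; exact hcw
  rw [htwo] at hZu
  linarith

/-- **THEOREM CONE-SPOKE (prim-lf-2 gen 70).**  Let `e ∈ E` be a root edge with ends `{x, p}`, `p ≠ x`, such that in `D = E.erase e` the vertex `p` is joined to every
vertex `v ∉ {x, p}` lying on an edge of `D` and to `x` by no edge of `D` (e.g. `E` = a full cone with apex `p` over any multigraph — a wheel at a spoke, `K_n` at any
edge — rooted at the BASE vertex `x`).  Then for EVERY target set `W` and every monotone `g`:  `0 ≤ REM_E(e;x,W)[g]`.
Proof: identity point rows (`rem_nonneg_of_dom_snd_of_rowN`) + the N-row on a cone (`rowN_sum_nonneg_of_cone`, via THEOREM APEX `cwpa_apex`).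
[cite: KozmaNitzan2024, Questions 8–9 (§5.5 p. 36) (context)] -/
theorem rem_nonneg_cone_spoke [Fintype V] (E : Finset ι) {e : ι} (he : e ∈ E) {x p : V} (hxp : ends e = s(x, p)) (hpx : p ≠ x)
    (hdom : ∀ e' ∈ E.erase e, ∀ v : V, v ∈ ends e' → v ≠ p → v ≠ x → ∃ f ∈ E.erase e, ends f = s(p, v))
    (hxpD : ∀ i ∈ E.erase e, x ∈ ends i → p ∉ ends i)
    (W : Set V) (g : Set V → ℝ) (hg : Monotone g) :
    0 ≤ ∑ s ∈ E.powerset.filter (fun s : Finset ι => e ∈ s ∧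
          ∀ w ∈ W, ¬ (w ∈ openCluster (ends '' (↑s : Set ι)) x ∧ w ∈ openCluster (ends '' (↑(E \ s) : Set ι)) x)),
      (g (openCluster (ends '' (↑s : Set ι)) x) - g (openCluster (ends '' (↑(E \ s) : Set ι)) x)) := by
  convert rem_nonneg_of_dom_snd_of_rowN ends E he hxp hpx hdom W g hg (rowN_sum_nonneg_of_cone ends (E.erase e) hpx hdom hxpD W g hg) using 3

end Coefficientwise

end Summit.CriticalPhenomena.PercolationContinuityZ3.Theorems
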